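import Summits.QuantumFields.BalabanUV.Beta.GAN24.PeriodicDataFaceSums

/-!
# `BalabanUV.Beta.GAN24.PeriodicCubeFaceSums` — binder row G-an2-4 ∕ (CONV-C), the (S) row ∕ (W-γ) one level up, the β-CHAIN (levels ≥ 2), FILE F1a:
# **FOR DATA `n` OF ANY PERIOD `P`, EVERY FACE SUM OF THE END-INSIDE ∕ BASE-OUTSIDE PARTIAL CONTOUR SUMS OF THE RESPONSE `H_j n` OVER A FACE OF A `P`-CUBE VANISHES** —
# `Σ_{r∈box P, r_μ = c} EI_{Lc}(H_j n) μ (P•Y + r) = 0 = Σ_{r∈box P, r_μ = c} BO_{Lc}(H_j n) μ (P•Y + r)`, `H_j n = Σ_l Σ'_t n(l,t)·colH G_j Lc l t`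
# (`Lc` odd, centred root, every `j`, EVERY period `P ≥ 1`, every bounded `P`-periodic `n`, every `μ`, `Y`, `c`)
# (G-an2-4 CRUX TEAM (2), seat `b2b-balaban-gan24-formalise-leaf-06` = the (γ) hand, gen 50, memo `LEVELS-GE2.md` §2 (iv))

NOT IN PRINT; OUR BOOKKEEPING ([folklore] BY NAME: gen 49's FILE (δ1) `ResponseResidueClassSums.tsum_blockWeight_mul_EI_colH_eq_zero ∕ _BO_` (block-weighted sums of the partial contour
sums of ONE response column vanish, ANY bounded single-coordinate block weight), FILE (δ2a) `PeriodicDataFaceSums` §1 (summability, residues), leaf-02's periodisation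
`BiStencilZeroMode.tsum_mul_periodic` ∕ `tsum_eq_sum_box_tsum` (any modulus), an4's `OneStepKernelFamily.colH_translate` with an2's `shiftK_coDressKBmAt_KInvStep`; 0 `def`, 0 cited
fact, 0 `def … : Prop`, 0 sorry).  THIS IS (δ2a) WITH THE PERIOD `Lc` OF THE DATA REPLACED BY AN ARBITRARY `P` (the kernel's blocking stays `Lc`); at `P := Lc` it is (δ2a) verbatim.
HONEST FRAMING (cell contract, verbatim): «discharging `BetaPertH` makes Bałaban's UV stability UNCONDITIONAL — a real constructive-QFT result; it is NOT the continuum limit and NOT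
the Clay problem.»  HONEST DEPENDENCY (verbatim): «continuum YM on T⁴ ⇐ BetaPertH ∧ nine spine estimates (0/9 proved); BetaPertH ⇐ (D1) ∧ (D4) ∧ CAP+tail; G-an2-4 gates asym,
D1 and NE2/3/4.»

WHY (memo `HOME/b2b-balaban-gan24-formalise-leaf-06/g50/LEVELS-GE2.md` §1–§2).  The level induction for road-P2's `hX` (`CubicSectorLevelDown.cubicSector_SrecAt_eq_levelDown`)
evaluates the level-`k` defect `(C2′)_k(h_k; n_k; ψ_k)` at DEPTH-`m` data: `n_k = H_{k+1} ⋯ H_j n` is `P = Lc^{m+1}`-PERIODIC (each field response multiplies the period by `Lc`,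
`colH_translate`), and the label `ψ_k = 𝟙_{B(y)} ∘ blk^m` is the indicator of a `P`-CUBE; the slot factor `C_k h_k` is a `P`-coarse gradient (`FieldResponseCoarseGradient` iterated),
constant on the faces of `P`-cubes.  So `(C2′)_k` reduces to the FACE SUMS of `U = (BO − EI)_{Lc}(H_k n_k)` over the exit faces `{P•W + r : r ∈ box P, r_μ = P − 1}` of `P`-cubes —
this file: they vanish for EVERY `P` and every face position `c`, by (δ2a)'s periodisation argument with modulus `P`: unfold `H_j n`, periodise the data index (`t = P•z + ρ`), move
the period translation onto the field leg (`colH(l, ρ + P•z)(μ, u) = colH(l, ρ)(μ, u − Lc•P•z)`) — the `P`-translates of the face sweep the residue class `{w : w_μ ≡ c (mod P)}` —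
and apply (δ1) with the block weight `𝟙[· ≡ c (mod P)]` to each column.  (gen 49's remark to leaf-02 g61 INFO (d): changing the modulus ALONE leaves transverse gaps for an `Lc`-block
face; it is the β-chain that first enlarges the face to a `P`-cube face, for which the `P`-translates tile.)
* §1 `summable_shift_colH_period` — a response column along the affine family `z ↦ Lc•(P•z + r) + b + s•e_μ`.
* §2 **`periodicCube_faceSum_eq_zero_of_blockWeight`** — the periodisation argument for ANY selection `sel b s` of contour positions whose block-weighted single-column sums vanish
  (hypothesis `hsel`, the shape of (δ1) §3); **`periodicCube_faceSum_EI_eq_zero`**, **`periodicCube_faceSum_BO_eq_zero`** — the instances (`hsel` := (δ1)).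
Asserts NO value of any resolvent column beyond FILE F + (γ); the multi-level defect vanishing itself (F1b) is the next file; NOTHING of `hX` at `j ≥ 1` ∕ (W-γ)_{≥2} ∕ (S) above
level 1 discharged; NEVER «G-an2-4 closed» as (CONV-C); NOT D1, NOT `BetaPertH`, NOT continuum, NOT Clay.  2026-08-23; no existing file touched.
-/

noncomputable section

open Finset
open scoped BigOperators
open Literature.MathematicalPhysics.QuantumFieldTheory
open Literature.MathematicalPhysics.QuantumFieldTheory.Balaban1983to89
open Literature.MathematicalPhysics.QuantumFieldTheory.Balaban1983to89.Beta
open ExpKernelCalculus (Site MKer Decays)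
open AffineAveraging (Form1 box toSite unitVec unitVec_apply)
open AveragingContoursRooted (ctrOff ctrOff_mem_box)
open OneStepKernelFamily (KInvStep colH colH_translate)
open Summit.QuantumFields.BalabanUV.Beta.AxialDressingRooted (coDressKBmAt decays_coDressKBmAt_KInvStep one_le_of_neZero shiftK_coDressKBmAt_KInvStep)
open Summit.QuantumFields.BalabanUV.Beta.SecondOrderSplitDecay (summable_colH_mul_bdd)
open Summit.QuantumFields.BalabanUV.Beta.GAN24.BiStencilZeroMode (tsum_eq_sum_box_tsum tsum_mul_periodic)
open Summit.QuantumFields.BalabanUV.Beta.GAN24.CoarseGaugeSourceResponse (summable_source_colH)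
open Summit.QuantumFields.BalabanUV.Beta.GAN24.ResponseResidueClassSums (tsum_blockWeight_mul_EI_colH_eq_zero tsum_blockWeight_mul_BO_colH_eq_zero)
open Summit.QuantumFields.BalabanUV.Beta.GAN24.PeriodicDataFaceSums (summable_abs_source_colH emod_coarse_add_box)

namespace Summit.QuantumFields.BalabanUV.Beta.GAN24.PeriodicCubeFaceSums

variable {d : ℕ} {Lc : ℕ} [NeZero Lc]

/-! ## §1 Summability along the period-`P` affine family -/

/-- [folklore] A response column is summable along the injective affine family of field points `z ↦ Lc•(P•z + r) + b + s•e_μ` (`P ≥ 1`). -/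
theorem summable_shift_colH_period (j : ℕ) {P : ℕ} [NeZero P] (l μ : Fin (d + 1)) (t : Site (d + 1)) (r b : Fin (d + 1) → ℕ) (s : ℕ) :
    Summable fun z : Site (d + 1) => colH (coDressKBmAt (toSite (ctrOff (d + 1) Lc)) Lc (KInvStep (d := d) Lc j)) Lc l t μ
      ((Lc : ℤ) • ((P : ℤ) • z + toSite r) + toSite b + (s : ℤ) • unitVec μ) := by
  have hLc1 : 1 ≤ Lc := one_le_of_neZero Lc
  obtain ⟨δG, CG, hδG, hCG, hG⟩ := decays_coDressKBmAt_KInvStep (d := d) (ctrOff_mem_box (d := d + 1) hLc1) j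
  have h1 : Summable fun u : Site (d + 1) => colH (coDressKBmAt (toSite (ctrOff (d + 1) Lc)) Lc (KInvStep (d := d) Lc j)) Lc l t μ u :=
    (summable_colH_mul_bdd (N := Lc) ⟨δG, CG, hδG, hCG, hG⟩ (T := fun _ => (1 : ℝ)) (B := 1) (fun _ => by simp) l t μ).congr fun u => by simp
  have hL : (Lc : ℤ) ≠ 0 := by exact_mod_cast NeZero.ne Lc
  have hP : (P : ℤ) ≠ 0 := by exact_mod_cast NeZero.ne P
  refine h1.comp_injective fun z z' h => ?_
  have h' : (Lc : ℤ) • ((P : ℤ) • z + toSite r) = (Lc : ℤ) • ((P : ℤ) • z' + toSite r) := by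
    have := congrArg (fun x => x - toSite b - (s : ℤ) • unitVec μ) h
    simpa using this
  funext i
  have := congrFun h' i
  simp only [Pi.smul_apply, Pi.add_apply, smul_eq_mul] at this
  have h2 := mul_left_cancel₀ hL this
  have h3 : (P : ℤ) * z i = (P : ℤ) * z' i := by linarith
  exact mul_left_cancel₀ hP h3

/-! ## §2 The face sums over `P`-cube faces for `P`-periodic data -/

/-- NOT IN PRINT; OUR BOOKKEEPING.  **THE PERIODISATION ARGUMENT, ANY PERIOD `P`** (`Lc ≥ 1`, centred root, every `j`; `P ≥ 1`; bounded `P`-periodic `n`; `μ`, `Y`, `c`; ANY decidable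
selection `sel b s` of contour positions): IF for every datum `(l, ρ)` and every bounded block weight `g` the block-weighted sum of the selected partial contour sum of the single column
`colH G_j(l, ρ)` vanishes (`hsel` — the shape of (δ1) §3), THEN the sum of the selected partial contour sum of `H_j n = Σ_l Σ'_t n l t·colH G_j(l,t)` over the face
`{P•Y + r : r ∈ box P, r_μ = c}` of the `P`-cube `Y` vanishes. -/
theorem periodicCube_faceSum_eq_zero_of_blockWeight (j : ℕ) {n : Form1 (d + 1) ℝ} {Bn : ℝ} (hnB : ∀ l t, |n l t| ≤ Bn)
    {P : ℕ} [NeZero P] (hper : ∀ (l : Fin (d + 1)) (t z : Site (d + 1)), n l (t + (P : ℤ) • z) = n l t) (μ : Fin (d + 1)) (Y : Site (d + 1)) (c : ℕ)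
    (sel : (Fin (d + 1) → ℕ) → ℕ → Prop) [∀ b s, Decidable (sel b s)]
    (hsel : ∀ (l : Fin (d + 1)) (ρ : Fin (d + 1) → ℕ) (g : ℤ → ℝ) (B : ℝ), (∀ z, |g z| ≤ B) →
      ∑' w : Site (d + 1), g (w μ) * ∑ b ∈ box (d + 1) Lc, ∑ s ∈ Finset.range Lc,
        (if sel b s then colH (coDressKBmAt (toSite (ctrOff (d + 1) Lc)) Lc (KInvStep (d := d) Lc j)) Lc l (toSite ρ) μ
          ((Lc : ℤ) • w + toSite b + (s : ℤ) • unitVec μ) else 0) = 0) :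
    ∑ r ∈ (box (d + 1) P).filter (fun r => r μ = c), ∑ b ∈ box (d + 1) Lc, ∑ s ∈ Finset.range Lc,
      (if sel b s then
        (∑ l, ∑' t : Site (d + 1), n l t * colH (coDressKBmAt (toSite (ctrOff (d + 1) Lc)) Lc (KInvStep (d := d) Lc j)) Lc l t μ
          ((Lc : ℤ) • ((P : ℤ) • Y + toSite r) + toSite b + (s : ℤ) • unitVec μ)) else 0) = 0 := by
  classical
  have hLc1 : 1 ≤ Lc := one_le_of_neZero Lc
  have hBn : 0 ≤ Bn := (abs_nonneg _).trans (hnB 0 0)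
  set G := coDressKBmAt (toSite (ctrOff (d + 1) Lc)) Lc (KInvStep (d := d) Lc j) with hGdef
  set pt : (Fin (d + 1) → ℕ) → (Fin (d + 1) → ℕ) → ℕ → Site (d + 1) → Site (d + 1) :=
    fun r b s Z => (Lc : ℤ) • ((P : ℤ) • Z + toSite r) + toSite b + (s : ℤ) • unitVec μ with hpt
  -- the selected single-column term, as a function of (datum t, block Z)
  set X : Fin (d + 1) → (Fin (d + 1) → ℕ) → (Fin (d + 1) → ℕ) → ℕ → Site (d + 1) → Site (d + 1) → ℝ :=
    fun l r b s t Z => if sel b s then colH G Lc l t μ (pt r b s Z) else 0 with hX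
  -- summability in the source index
  have hXs : ∀ l r b s, Summable fun t : Site (d + 1) => n l t * X l r b s t Y := by
    intro l r b s
    by_cases h : sel b s
    · simp only [hX, if_pos h]
      exact Summable.of_norm_bounded ((summable_abs_source_colH j l μ (pt r b s Y)).mul_left Bn) fun t => by
        rw [Real.norm_eq_abs, abs_mul]; exact mul_le_mul_of_nonneg_right (hnB l t) (abs_nonneg _)
    · simp only [hX, if_neg h, mul_zero]; exact summable_zero
  -- step A: the summand is `Σ_l Σ'_t n l t * X`
  have eA : ∀ r b s, (if sel b s then (∑ l, ∑' t : Site (d + 1), n l t * colH G Lc l t μ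
        ((Lc : ℤ) • ((P : ℤ) • Y + toSite r) + toSite b + (s : ℤ) • unitVec μ)) else 0)
      = ∑ l, ∑' t : Site (d + 1), n l t * X l r b s t Y := by
    intro r b s
    by_cases h : sel b s
    · simp only [hX, hpt, if_pos h]
    · simp only [hX, if_neg h, mul_zero, tsum_zero, Finset.sum_const_zero]
  rw [Finset.sum_congr rfl fun r _ => Finset.sum_congr rfl fun b _ => Finset.sum_congr rfl fun s _ => eA r b s]
  -- bring `Σ_l` outside and work per `l`
  rw [show (∑ r ∈ (box (d + 1) P).filter (fun r => r μ = c), ∑ b ∈ box (d + 1) Lc, ∑ s ∈ Finset.range Lc, ∑ l, ∑' t : Site (d + 1), n l t * X l r b s t Y)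
      = ∑ l, ∑ r ∈ (box (d + 1) P).filter (fun r => r μ = c), ∑ b ∈ box (d + 1) Lc, ∑ s ∈ Finset.range Lc, ∑' t : Site (d + 1), n l t * X l r b s t Y from by
    calc _ = ∑ r ∈ (box (d + 1) P).filter (fun r => r μ = c), ∑ b ∈ box (d + 1) Lc, ∑ l, ∑ s ∈ Finset.range Lc, ∑' t : Site (d + 1), n l t * X l r b s t Y :=
          Finset.sum_congr rfl fun r _ => Finset.sum_congr rfl fun b _ => Finset.sum_comm
      _ = ∑ r ∈ (box (d + 1) P).filter (fun r => r μ = c), ∑ l, ∑ b ∈ box (d + 1) Lc, ∑ s ∈ Finset.range Lc, ∑' t : Site (d + 1), n l t * X l r b s t Y :=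
          Finset.sum_congr rfl fun r _ => Finset.sum_comm
      _ = _ := Finset.sum_comm]
  refine Finset.sum_eq_zero fun l _ => ?_
  -- collect into one series
  have eB : (∑ r ∈ (box (d + 1) P).filter (fun r => r μ = c), ∑ b ∈ box (d + 1) Lc, ∑ s ∈ Finset.range Lc, ∑' t : Site (d + 1), n l t * X l r b s t Y)
      = ∑' t : Site (d + 1), (∑ r ∈ (box (d + 1) P).filter (fun r => r μ = c), ∑ b ∈ box (d + 1) Lc, ∑ s ∈ Finset.range Lc, X l r b s t Y) * n l t := by
    symm
    rw [show (fun t : Site (d + 1) => (∑ r ∈ (box (d + 1) P).filter (fun r => r μ = c), ∑ b ∈ box (d + 1) Lc, ∑ s ∈ Finset.range Lc, X l r b s t Y) * n l t)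
        = fun t => ∑ r ∈ (box (d + 1) P).filter (fun r => r μ = c), ∑ b ∈ box (d + 1) Lc, ∑ s ∈ Finset.range Lc, n l t * X l r b s t Y from by
      funext t
      rw [Finset.sum_mul]
      refine Finset.sum_congr rfl fun r _ => ?_
      rw [Finset.sum_mul]
      refine Finset.sum_congr rfl fun b _ => ?_
      rw [Finset.sum_mul]
      exact Finset.sum_congr rfl fun s _ => mul_comm _ _]
    rw [Summable.tsum_finsetSum (fun r _ => summable_sum fun b _ => summable_sum fun s _ => hXs l r b s)]
    refine Finset.sum_congr rfl fun r _ => ?_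
    rw [Summable.tsum_finsetSum (fun b _ => summable_sum fun s _ => hXs l r b s)]
    refine Finset.sum_congr rfl fun b _ => ?_
    exact Summable.tsum_finsetSum (fun s _ => hXs l r b s)
  rw [eB]
  -- step B: periodise the data index
  have hsB : Summable fun t : Site (d + 1) => (∑ r ∈ (box (d + 1) P).filter (fun r => r μ = c), ∑ b ∈ box (d + 1) Lc, ∑ s ∈ Finset.range Lc, X l r b s t Y) * n l t := by
    have := summable_sum (s := (box (d + 1) P).filter (fun r => r μ = c)) fun r _ =>
      summable_sum (s := box (d + 1) Lc) fun b _ => summable_sum (s := Finset.range Lc) fun s _ => hXs l r b s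
    refine this.congr fun t => ?_
    simp only [Finset.sum_mul]
    refine Finset.sum_congr rfl fun r _ => Finset.sum_congr rfl fun b _ => Finset.sum_congr rfl fun s _ => mul_comm _ _
  rw [tsum_mul_periodic (N := P) (fun u z => hper l u z) hsB]
  refine Finset.sum_eq_zero fun ρ hρ => ?_
  -- step C: per residue class of the datum, the series over the period translations is a block-weighted single-column sum
  -- (i) move the translation onto the field leg
  have etr : ∀ (z : Site (d + 1)) r b s, X l r b s ((P : ℤ) • z + toSite ρ) Y = X l r b s (toSite ρ) (Y - z) := by
    intro z r b s
    simp only [hX]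
    split_ifs with h
    · rw [add_comm ((P : ℤ) • z) (toSite ρ), hGdef,
        colH_translate (shiftK_coDressKBmAt_KInvStep (toSite (ctrOff (d + 1) Lc)) j) l (toSite ρ) ((P : ℤ) • z) μ]
      congr 1
      simp only [hpt, smul_add, smul_sub]
      abel
    · rfl
  simp only [etr]
  -- (ii) reindex `z ↦ Y − z`
  have ere : (∑' z : Site (d + 1), ∑ r ∈ (box (d + 1) P).filter (fun r => r μ = c), ∑ b ∈ box (d + 1) Lc, ∑ s ∈ Finset.range Lc, X l r b s (toSite ρ) (Y - z))
      = ∑' z : Site (d + 1), ∑ r ∈ (box (d + 1) P).filter (fun r => r μ = c), ∑ b ∈ box (d + 1) Lc, ∑ s ∈ Finset.range Lc, X l r b s (toSite ρ) z := by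
    rw [← (Equiv.subLeft Y).tsum_eq (fun z => ∑ r ∈ (box (d + 1) P).filter (fun r => r μ = c), ∑ b ∈ box (d + 1) Lc, ∑ s ∈ Finset.range Lc, X l r b s (toSite ρ) z)]
    rfl
  rw [ere]
  -- (iii) the block weight `g = 𝟙[· % Lc = c]` and (δ1)'s shape
  set g : ℤ → ℝ := fun S => if S % (P : ℤ) = (c : ℤ) then 1 else 0 with hg
  have hgb : ∀ S, |g S| ≤ 1 := fun S => by simp only [hg]; split <;> simp
  have key := hsel l ρ g 1 hgb
  -- expand (δ1)'s series by blocks of the `w`-lattice: `w = Lc•z + r`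
  set EIv : Site (d + 1) → ℝ := fun w => ∑ b ∈ box (d + 1) Lc, ∑ s ∈ Finset.range Lc,
    (if sel b s then colH G Lc l (toSite ρ) μ ((Lc : ℤ) • w + toSite b + (s : ℤ) • unitVec μ) else 0) with hEIv
  have hEs : Summable fun w : Site (d + 1) => g (w μ) * EIv w := by
    have h1 : Summable fun w : Site (d + 1) => EIv w := by
      refine summable_sum fun b _ => summable_sum fun s _ => ?_
      by_cases h : sel b s
      · simp only [if_pos h]
        -- `w ↦ colH(…)(Lc•w + b + s e)` : the affine family with `r = 0`, blocks of the `w`-lattice read as `Lc•(Lc•z' + r')`? use the finer decomposition directly: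
        obtain ⟨δG, CG, hδG, hCG, hG⟩ := decays_coDressKBmAt_KInvStep (d := d) (ctrOff_mem_box (d := d + 1) hLc1) j
        have hc1 : Summable fun u : Site (d + 1) => colH G Lc l (toSite ρ) μ u :=
          (summable_colH_mul_bdd (N := Lc) ⟨δG, CG, hδG, hCG, hG⟩ (T := fun _ => (1 : ℝ)) (B := 1) (fun _ => by simp) l (toSite ρ) μ).congr fun u => mul_one _
        have hL : (Lc : ℤ) ≠ 0 := by exact_mod_cast NeZero.ne Lc
        have hinj : Function.Injective fun w : Site (d + 1) => (Lc : ℤ) • w + toSite b + (s : ℤ) • unitVec μ := by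
          intro w w' h
          have h' : (Lc : ℤ) • w = (Lc : ℤ) • w' := by
            have := congrArg (fun x => x - toSite b - (s : ℤ) • unitVec μ) h
            simpa using this
          funext i
          have := congrFun h' i
          simp only [Pi.smul_apply, smul_eq_mul] at this
          exact mul_left_cancel₀ hL this
        exact hc1.comp_injective hinj
      · simp only [if_neg h]; exact summable_zero
    exact Summable.of_norm_bounded h1.abs (fun w => by
      rw [Real.norm_eq_abs, abs_mul]
      exact (mul_le_mul_of_nonneg_right (hgb _) (abs_nonneg _)).trans (by rw [one_mul]))
  have hkey : ∑' w : Site (d + 1), g (w μ) * EIv w = 0 := key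
  rw [tsum_eq_sum_box_tsum (N := P) hEs] at hkey
  -- per box point `r`: the weight is `[r_μ = c]`
  have hval : ∀ r ∈ box (d + 1) P, ∀ z : Site (d + 1), g (((P : ℤ) • z + toSite r) μ) = if r μ = c then 1 else 0 := by
    intro r hr z
    simp only [hg, emod_coarse_add_box (Lc := P) z hr μ]
    by_cases h : r μ = c
    · rw [if_pos (by exact_mod_cast h), if_pos h]
    · rw [if_neg (fun h' => h (by exact_mod_cast h')), if_neg h]
  have e3 : (∑ r ∈ box (d + 1) P, ∑' z : Site (d + 1), g (((P : ℤ) • z + toSite r) μ) * EIv ((P : ℤ) • z + toSite r))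
      = ∑ r ∈ (box (d + 1) P).filter (fun r => r μ = c), ∑' z : Site (d + 1), EIv ((P : ℤ) • z + toSite r) := by
    rw [Finset.sum_filter]
    refine Finset.sum_congr rfl fun r hr => ?_
    by_cases h : r μ = c
    · rw [if_pos h]; exact tsum_congr fun z => by rw [hval r hr z, if_pos h, one_mul]
    · rw [if_neg h]
      have hz : (fun z : Site (d + 1) => g (((P : ℤ) • z + toSite r) μ) * EIv ((P : ℤ) • z + toSite r)) = fun _ => 0 := by
        funext z; rw [hval r hr z, if_neg h, zero_mul]
      rw [hz, tsum_zero]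
  have hkey' : ∑ r ∈ (box (d + 1) P).filter (fun r => r μ = c), ∑' z : Site (d + 1), EIv ((P : ℤ) • z + toSite r) = 0 := by
    rw [← e3]; exact hkey
  -- the goal's series equals `Σ_{r∈filter} Σ'_z EIv (Lc•z + r)`
  have hXE : ∀ (z : Site (d + 1)) r, (∑ b ∈ box (d + 1) Lc, ∑ s ∈ Finset.range Lc, X l r b s (toSite ρ) z) = EIv ((P : ℤ) • z + toSite r) := by
    intro z r
    simp only [hX, hEIv, hpt]
  have hzs : ∀ r, Summable fun z : Site (d + 1) => EIv ((P : ℤ) • z + toSite r) := by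
    intro r
    have : Summable fun z : Site (d + 1) => ∑ b ∈ box (d + 1) Lc, ∑ s ∈ Finset.range Lc, X l r b s (toSite ρ) z := by
      refine summable_sum fun b _ => summable_sum fun s _ => ?_
      by_cases h : sel b s
      · simp only [hX, if_pos h, hpt]; exact summable_shift_colH_period j l μ (toSite ρ) r b s
      · simp only [hX, if_neg h]; exact summable_zero
    exact this.congr fun z => hXE z r
  have egoal : (∑' z : Site (d + 1), ∑ r ∈ (box (d + 1) P).filter (fun r => r μ = c), ∑ b ∈ box (d + 1) Lc, ∑ s ∈ Finset.range Lc, X l r b s (toSite ρ) z)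
      = ∑ r ∈ (box (d + 1) P).filter (fun r => r μ = c), ∑' z : Site (d + 1), EIv ((P : ℤ) • z + toSite r) := by
    have e2 : ∀ z : Site (d + 1), (∑ r ∈ (box (d + 1) P).filter (fun r => r μ = c), ∑ b ∈ box (d + 1) Lc, ∑ s ∈ Finset.range Lc, X l r b s (toSite ρ) z)
        = ∑ r ∈ (box (d + 1) P).filter (fun r => r μ = c), EIv ((P : ℤ) • z + toSite r) := by
      intro z
      exact Finset.sum_congr rfl fun r _ => hXE z r
    rw [tsum_congr e2, Summable.tsum_finsetSum (fun r _ => hzs r)]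
  rw [egoal, hkey', mul_zero]

/-- NOT IN PRINT; OUR BOOKKEEPING.  **THE END-INSIDE FACE SUMS OF `H_j n` OVER `P`-CUBE FACES VANISH FOR `P`-PERIODIC `n`** (`Lc` odd, centred root, every `j`; `P ≥ 1`; `n` bounded
and `P`-periodic; every `μ`, `Y`, `c`): `Σ_{r∈box P, r_μ=c} EI_{Lc}(H_j n) μ (P•Y + r) = 0`, `H_j n μ u = Σ_l Σ'_t n l t·colH G_j Lc l t μ u` written inline. -/
theorem periodicCube_faceSum_EI_eq_zero (hLc : Odd Lc) (j : ℕ) {n : Form1 (d + 1) ℝ} {Bn : ℝ} (hnB : ∀ l t, |n l t| ≤ Bn)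
    {P : ℕ} [NeZero P] (hper : ∀ (l : Fin (d + 1)) (t z : Site (d + 1)), n l (t + (P : ℤ) • z) = n l t) (μ : Fin (d + 1)) (Y : Site (d + 1)) (c : ℕ) :
    ∑ r ∈ (box (d + 1) P).filter (fun r => r μ = c), ∑ b ∈ box (d + 1) Lc, ∑ s ∈ Finset.range Lc,
      (if b μ + s + 1 < Lc then
        (∑ l, ∑' t : Site (d + 1), n l t * colH (coDressKBmAt (toSite (ctrOff (d + 1) Lc)) Lc (KInvStep (d := d) Lc j)) Lc l t μ
          ((Lc : ℤ) • ((P : ℤ) • Y + toSite r) + toSite b + (s : ℤ) • unitVec μ)) else 0) = 0 := by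
  classical
  exact periodicCube_faceSum_eq_zero_of_blockWeight j hnB hper μ Y c (fun b s => b μ + s + 1 < Lc)
    (fun l ρ g B hg => tsum_blockWeight_mul_EI_colH_eq_zero hLc j l μ (toSite ρ) g hg)

/-- NOT IN PRINT; OUR BOOKKEEPING.  **THE BASE-OUTSIDE FACE SUMS OF `H_j n` OVER `P`-CUBE FACES VANISH FOR `P`-PERIODIC `n`**: `Σ_{r∈box P, r_μ=c} BO_{Lc}(H_j n) μ (P•Y + r) = 0`
(same hypotheses). -/
theorem periodicCube_faceSum_BO_eq_zero (hLc : Odd Lc) (j : ℕ) {n : Form1 (d + 1) ℝ} {Bn : ℝ} (hnB : ∀ l t, |n l t| ≤ Bn)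
    {P : ℕ} [NeZero P] (hper : ∀ (l : Fin (d + 1)) (t z : Site (d + 1)), n l (t + (P : ℤ) • z) = n l t) (μ : Fin (d + 1)) (Y : Site (d + 1)) (c : ℕ) :
    ∑ r ∈ (box (d + 1) P).filter (fun r => r μ = c), ∑ b ∈ box (d + 1) Lc, ∑ s ∈ Finset.range Lc,
      (if Lc ≤ b μ + s then
        (∑ l, ∑' t : Site (d + 1), n l t * colH (coDressKBmAt (toSite (ctrOff (d + 1) Lc)) Lc (KInvStep (d := d) Lc j)) Lc l t μ
          ((Lc : ℤ) • ((P : ℤ) • Y + toSite r) + toSite b + (s : ℤ) • unitVec μ)) else 0) = 0 := by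
  classical
  exact periodicCube_faceSum_eq_zero_of_blockWeight j hnB hper μ Y c (fun b s => Lc ≤ b μ + s)
    (fun l ρ g B hg => tsum_blockWeight_mul_BO_colH_eq_zero hLc j l μ (toSite ρ) g hg)

end Summit.QuantumFields.BalabanUV.Beta.GAN24.PeriodicCubeFaceSums

end
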